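import Mathlib
import Literature.ComputerArithmetic.Higham2002.Gamma

/-!
# Summation on a computational tree: exact error expressions and deterministic bounds
(Hallman–Ipsen 2023, §2 and §4.1), with the classical bounds of Higham (1993, §§2–3)

Honest framing: this file is a MODEL-FORM formalisation written for the shared numerical engines
serving client cells; rigour lives in the verifiers; every published number belongs to a client
cell's ledger, not to the engines group. It states and proves, over an arbitrary linearly ordered
field `K` and with the rounding errors as explicit variables, the published deterministic
(worst-case) part of the rounding-error analysis of GENERAL summation — summation in any order,
represented by its computational tree — and the exact error recurrences of compensated summation.
Nothing here is new mathematics; every declaration carries its source locator.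

## Sources

* E. Hallman, I. C. F. Ipsen, *Precision-aware deterministic and probabilistic error bounds for
  floating point summation*, Numer. Math. 155 (2023) 83–119, doi 10.1007/s00211-023-01370-y,
  arXiv:2203.15928 — bib key `HallmanIpsen2023`. NUMBERING CAVEAT: the held text is the arXiv
  source; items are cited by section, by TITLE and by the running number of that text
  (Definition 4 "Computational tree" (label d:tree), Lemma 5 "Relation between partial sums and
  inputs" (l_rel), Lemma 6 "First explicit expression" (lemma:forwardErrorGenl), Theorem 7
  (t_gdet, the deterministic bound), Remark 8, Lemma 9 "Second explicit expression"
  (lemma:forwardErrorRec), Example 10, and in §4 the model (e_model1), the error definitions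
  (def:compFwdErr), (def:compChiErr), the recursions (eqn:comp_ydot)–(eqn:comp_cdot) and
  Theorem 19 with (eqn:cbase), (eqn:yrec), (eqn:srec), (eqn:zrec), (eqn:crec)); the journal
  version's theorem numbers may differ by a constant offset.
* N. J. Higham, *The accuracy of floating point summation*, SIAM J. Sci. Comput. 14 (1993)
  783–799, doi 10.1137/0914050 — bib key `Higham1993`; cited by page and equation number
  (§2 recursive summation (2.1)–(2.6), §3 the general class `T_k = T_{k₁} + T_{k₂}` (3.1)–(3.4) and
  pairwise summation (3.5)–(3.6)).
* `Literature.ComputerArithmetic.Higham2002.Gamma` supplies `γ_n(u) = nu/(1 − nu)` and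
  `(1+u)^n − 1 ≤ γ_n` (Higham's `θ`/`γ` lemma), used only to restate the pairwise bound with `γ`.

## Contents (all statements in MODEL form: `ŝ = (x̂ + ŷ)(1 + δ)`, `|δ| ≤ u`, no floating-point format)

PART A — `CompTree K`, the computational tree (HI Def. 4): `exact` (`s_k`), `comp` (`ŝ_k`), `err`
(`e_k = ŝ_k − s_k`), `height`, `inputs`, `absInputs = Σ|x_j|`, `sumAbsPartial = Σ_{k≥2}|s_k|`,
`sumSqPartial`, `sumAbsComp = Σ|ŝ_k|`, `Roundoff u` (all `|δ_k| ≤ u`).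
* HI Lemma 5: `sumAbsPartial_le` (`Σ|s_k| ≤ h Σ|x_j|`), `sumSqPartial_le` (`Σ s_k² ≤ h (Σ|x_j|)²`,
  the squared form of the printed `√`-inequality).
* HI Lemma 6: `err_eq_sum_firstTerms` (`e_n = Σ_k s_k δ_k ∏_{k≺j⪯n}(1+δ_j)`).
* HI Theorem 7: `abs_err_le_sum_firstAbsTerms`, `sum_firstAbsTerms_le`, `lambda_mul_sumAbsPartial_le`,
  packaged as `abs_err_le` (`|e_n| ≤ λ_h u Σ|s_k| ≤ λ_h h u Σ|x_j|`, `λ_h = (1+u)^h`).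
* HI Lemma 9: `err_eq_sum_secondTerms'` (`e_n = Σ_j (s_j + f_j) δ_j`), `childErr_node`
  (`f_k = Σ_{j≺k}(s_j+f_j)δ_j`), `err_node_eq_childErr` (`e_k = f_k + (s_k + f_k)δ_k`).
* Higham 1993 (3.2)–(3.3): `err_eq_sum_localErrs` (`E_n = Σ_k T̂_k δ_k/(1+δ_k)`, exactly, no
  perturbation factors), `localErr_eq_div`; (3.4): `abs_err_le_sumAbsComp`
  (`|E_n| ≤ u/(1−u) · Σ|T̂_k|`); (2.2): `comp_eq_sum_leafTerms`; (2.4)–(2.6), (3.6):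
  `abs_err_le_leafBound`, `leafBound_le`, `abs_err_le_gamma`
  (`|E_n| ≤ ((1+u)^h − 1) Σ|x_i| ≤ γ_h Σ|x_i|`).
* The two standard trees: `recursiveTree` (height `n − 1`, `recursiveTree_inputs_height`) and
  `pairwiseTree` (height `≤ ⌈log₂ n⌉`, `pairwiseTree_inputs_height`), with the pairwise bound
  `pairwise_abs_err_le` (`|E_n| ≤ ((1+u)^{⌈log₂ n⌉} − 1) Σ|x_i|`, Higham (3.6)).

PART B — `Compensated.state` etc., the finite-precision model (e_model1) of compensated (Kahan)
summation with four roundoffs `η_k, σ_k, δ_k, β_k` per step, the forward errors `ẏ ṡ ż ċ`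
(def:compFwdErr) and child-errors `ÿ s̈ z̈ c̈` (def:compChiErr); the recursions `dY_eq`, `dS_eq`,
`dZ_eq`, `dC_eq` ((eqn:comp_ydot)–(eqn:comp_cdot)) and HI Theorem 19: `base` (eqn:cbase),
`ddY_rec` (yrec), `ddC_rec` (crec), `ddZ_rec` (zrec), `ddS_step` and `ddS_eq_sum` (srec).

## Typing notes

* MODEL form throughout: the rounding errors are free variables of `K` constrained only by
  `|δ| ≤ u` (HI §1.2 "Individual roundoffs", Higham (1.2)); no statement about a floating-point
  FORMAT is made or needed. Leaves (inputs) are exact.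
* Higham's (3.4) is printed for the general class (3.1) with his `u/(1−u)`-type constant coming
  from `|δ_k/(1+δ_k)| ≤ u/(1−u)`; we prove exactly `|E_n| ≤ u/(1−u) Σ_k |T̂_k|` under `u < 1`
  (HI Remark 8 quotes the first-order form `|e_n| ≤ u Σ|ŝ_k|`).
* HI Lemma 5's second inequality is stated squared (`Σ s_k² ≤ h (Σ|x_j|)²`) to stay inside an
  ordered field (no square roots); it is equivalent to the printed form.
* Higham's ordering-dependent bound (2.4)–(2.5) is printed with `γ_k`; we prove the slightly
  stronger intermediate form with `(1+u)^k − 1` (`≤ γ_k`, `Higham2002.one_add_pow_sub_one_le_gamma`)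
  summed leafwise as the structural recursion `leafBound`, and then Higham's `γ_h` form.
* NOT formalised: HI's probabilistic material (§2.2–§3, §4.3, §5: Theorems 12–18, 23–28), the
  asymptotic Corollary 20 (`O(u³)`) and Remark 21; Higham's statistical estimates (2.8)–(2.9),
  insertion / `Ψ`-orderings and §4 (compensated, doubly compensated summation).
-/

namespace Literature.ComputerArithmetic.HallmanIpsen2023

open Literature.ComputerArithmetic.Higham2002 (gamma one_add_pow_sub_one_le_gamma)

/-- The COMPUTATIONAL TREE of a general summation algorithm, in MODEL form: a leaf is an input
`x_j` (a floating-point number, stored exactly); a node is a pairwise sum `s_k = x + y` of the values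
of its two children and carries the relative rounding error `δ_k` committed when that sum is
evaluated, `ŝ_k = (x̂ + ŷ)(1 + δ_k)`.
[cite: HallmanIpsen2023, §2, Algorithm 2.1 and Definition "Computational tree" (Def. 4 of the arXiv text); §1.2 eq. `fl(x op y) = (x op y)(1 + δ)`] -/
inductive CompTree (K : Type*) where
  | leaf (x : K) : CompTree K
  | node (δ : K) (l r : CompTree K) : CompTree K

namespace CompTree

variable {K : Type*} [Field K] [LinearOrder K] [IsStrictOrderedRing K]

/-- Exact value of the (partial) sum represented by a tree: `s_k`.
[cite: HallmanIpsen2023, §2, "Denote by s_k the exact partial sum"] -/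
def exact : CompTree K → K
  | leaf x => x
  | node _ l r => exact l + exact r

/-- Computed value `ŝ_k`: leaves are exact, `ŝ_k = (x̂ + ŷ)(1 + δ_k)` at every node.
[cite: HallmanIpsen2023, §2.1, proof of Lemma "Second explicit expression": `ŝ_k = (x̂ + ŷ)(1+δ_k)`] -/
def comp : CompTree K → K
  | leaf x => x
  | node δ l r => (comp l + comp r) * (1 + δ)

/-- Absolute forward error `e_k = ŝ_k − s_k` of the sum represented by the tree.
[cite: HallmanIpsen2023, §2, "e_k = ŝ_k − s_k the absolute forward error"] -/
def err (t : CompTree K) : K := t.comp - t.exact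

/-- Height of the computational tree (leaves have height zero).
[cite: HallmanIpsen2023, §2, Definition "Computational tree": height] -/
def height : CompTree K → ℕ
  | leaf _ => 0
  | node _ l r => max (height l) (height r) + 1

/-- The inputs `x_1, …, x_n` (the leaves, left to right).
[cite: HallmanIpsen2023, §2, Definition "Computational tree": "the leaves are the inputs"] -/
def inputs : CompTree K → List K
  | leaf x => [x]
  | node _ l r => inputs l ++ inputs r

/-- `Σ_j |x_j|`, the sum of the absolute values of the inputs.
[cite: HallmanIpsen2023, §2, Lemma "Relation between partial sums and inputs"] -/
def absInputs : CompTree K → K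
  | leaf x => |x|
  | node _ l r => absInputs l + absInputs r

/-- `Σ_{k=2}^{n} |s_k|`, the sum of the absolute values of the EXACT partial sums (one per node).
[cite: HallmanIpsen2023, §2, Lemma "Relation between partial sums and inputs"] -/
def sumAbsPartial : CompTree K → K
  | leaf _ => 0
  | node _ l r => |exact l + exact r| + sumAbsPartial l + sumAbsPartial r

/-- `Σ_{k=2}^{n} s_k²`. [cite: HallmanIpsen2023, §2, Lemma "Relation between partial sums and inputs"] -/
def sumSqPartial : CompTree K → K
  | leaf _ => 0
  | node _ l r => (exact l + exact r) ^ 2 + sumSqPartial l + sumSqPartial r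

/-- `Σ_k |ŝ_k|`, the sum of the absolute values of the COMPUTED partial sums (one per node).
[cite: HallmanIpsen2023, §2.1, Remark 8 of the arXiv text (`|e_n| ≤ u Σ |ŝ_k|`, quoting
Higham); Higham1993, p. 787, eq. (3.4)] -/
def sumAbsComp : CompTree K → K
  | leaf _ => 0
  | node δ l r => |(comp l + comp r) * (1 + δ)| + sumAbsComp l + sumAbsComp r

/-- The roundoff model: every rounding error in the tree satisfies `|δ_k| ≤ u`.
[cite: HallmanIpsen2023, §1.2, "Individual roundoffs": `fl(x op y) = (x op y)(1+δ)`, `|δ| ≤ u`] -/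
def Roundoff (u : K) : CompTree K → Prop
  | leaf _ => True
  | node δ l r => |δ| ≤ u ∧ Roundoff u l ∧ Roundoff u r

/-- The terms `s_k δ_k ∏_{k ≺ j ⪯ n} (1 + δ_j)` of the FIRST explicit error expression, one per
node `k` (the product is over the strict ancestors `j` of `k`).
[cite: HallmanIpsen2023, §2.1, Lemma "First explicit expression"] -/
def firstTerms : CompTree K → List K
  | leaf _ => []
  | node δ l r => ((exact l + exact r) * δ) :: (firstTerms l ++ firstTerms r).map (· * (1 + δ))

/-- The terms `|s_k| |δ_k| ∏_{k ≺ j ⪯ n} |1 + δ_j|`.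
[cite: HallmanIpsen2023, §2.1, Theorem "deterministic bound", first inequality] -/
def firstAbsTerms : CompTree K → List K
  | leaf _ => []
  | node δ l r => (|exact l + exact r| * |δ|) :: (firstAbsTerms l ++ firstAbsTerms r).map (· * |1 + δ|)

/-- The CHILD-ERROR `f_k` of a node: the sum of the errors of its two computed children
(`0` when both children are leaves). [cite: HallmanIpsen2023, §2.1, Lemma "Second explicit
expression" and its proof ("f_k is equal to the sum of the errors in the computed children")] -/
def childErr : CompTree K → K
  | leaf _ => 0
  | node _ l r => err l + err r

/-- The terms `(s_j + f_j) δ_j` of the SECOND explicit error expression, one per node.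
[cite: HallmanIpsen2023, §2.1, Lemma "Second explicit expression"] -/
def secondTerms : CompTree K → List K
  | leaf _ => []
  | node δ l r => ((exact l + exact r + (err l + err r)) * δ) :: (secondTerms l ++ secondTerms r)

/-- Higham's local errors `(T̂_{k₁} + T̂_{k₂}) δ_k = T̂_k δ_k / (1 + δ_k)`, one per node.
[cite: Higham1993, p. 787, eqs. (3.2)–(3.3)] -/
def localErrs : CompTree K → List K
  | leaf _ => []
  | node δ l r => ((comp l + comp r) * δ) :: (localErrs l ++ localErrs r)

/-- The leafwise expansion `x_i ∏ (1 + δ)` of the computed sum: each input times the rounding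
factors of all the additions it takes part in.
[cite: Higham1993, eq. (2.2) (recursive summation) and p. 788 (pairwise summation)] -/
def leafTerms : CompTree K → List K
  | leaf x => [x]
  | node δ l r => (leafTerms l ++ leafTerms r).map (· * (1 + δ))

/-- `Σ_i |x_i| ((1 + u)^{d_i} − 1)`, where `d_i` is the number of additions the input `x_i` takes
part in (its depth in the tree), written as a structural recursion.
[cite: Higham1993, eqs. (2.4)–(2.5) and (3.6)] -/
def leafBound (u : K) : CompTree K → K
  | leaf _ => 0
  | node _ l r => (1 + u) * (leafBound u l + leafBound u r) + u * (absInputs l + absInputs r)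

section Basic

omit [LinearOrder K] [IsStrictOrderedRing K] in
/-- An input is stored exactly: `e = 0` at a leaf. [cite: HallmanIpsen2023, §2.1, proof of Lemma
"Second explicit expression" ("e_x = e_y = 0 if x and y are inputs")] -/
@[simp] theorem err_leaf (x : K) : (leaf x).err = 0 := by simp [err, comp, exact]

omit [LinearOrder K] [IsStrictOrderedRing K] in
/-- Error propagation through one node: `e = (e_x + e_y)(1 + δ_k) + s_k δ_k`.
[cite: HallmanIpsen2023, §2.1, proof of Lemma "Second explicit expression"] -/
theorem err_node (δ : K) (l r : CompTree K) :
    (node δ l r).err = (l.err + r.err) * (1 + δ) + (l.exact + r.exact) * δ := by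
  simp only [err, comp, exact]; ring

omit [LinearOrder K] [IsStrictOrderedRing K] in
/-- `e_k = f_k + (s_k + f_k) δ_k`. [cite: HallmanIpsen2023, §2.1, proof of Lemma "Second explicit
expression", last display] -/
theorem err_node_eq_childErr (δ : K) (l r : CompTree K) :
    (node δ l r).err = (node δ l r).childErr + ((node δ l r).exact + (node δ l r).childErr) * δ := by
  simp only [err, childErr, comp, exact]; ring

omit [LinearOrder K] [IsStrictOrderedRing K] in
/-- A node both of whose children are leaves has child-error `f_k = 0`.
[cite: HallmanIpsen2023, §2.1, Lemma "Second explicit expression" ("f_j = 0 for all nodes whose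
children are leaves")] -/
@[simp] theorem childErr_node_leaf_leaf (δ x y : K) : (node δ (leaf x) (leaf y)).childErr = 0 := by
  simp [childErr]

/-- `0 ≤ Σ_j |x_j|`. [cite: HallmanIpsen2023, §2, Lemma "Relation between partial sums and inputs"] -/
theorem absInputs_nonneg : ∀ t : CompTree K, 0 ≤ t.absInputs
  | leaf x => abs_nonneg x
  | node _ l r => add_nonneg (absInputs_nonneg l) (absInputs_nonneg r)

/-- `0 ≤ Σ_k |s_k|`. [cite: HallmanIpsen2023, §2, Lemma "Relation between partial sums and inputs"] -/
theorem sumAbsPartial_nonneg : ∀ t : CompTree K, 0 ≤ t.sumAbsPartial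
  | leaf _ => le_rfl
  | node _ l r => by
      simp only [sumAbsPartial]
      have := sumAbsPartial_nonneg l; have := sumAbsPartial_nonneg r; positivity

omit [IsStrictOrderedRing K] in
/-- `Σ_j |x_j|` is the sum of the absolute values of the leaves.
[cite: HallmanIpsen2023, §2, Definition "Computational tree" ("the leaves are the inputs")] -/
theorem absInputs_eq_sum : ∀ t : CompTree K, t.absInputs = (t.inputs.map (|·|)).sum
  | leaf x => by simp [absInputs, inputs]
  | node _ l r => by simp [absInputs, inputs, absInputs_eq_sum l, absInputs_eq_sum r]

omit [LinearOrder K] [IsStrictOrderedRing K] in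
/-- `s_n = Σ_j x_j`: the root is the sum of the inputs.
[cite: HallmanIpsen2023, §2, Definition "Computational tree" ("The root is the final sum s_n")] -/
theorem exact_eq_sum : ∀ t : CompTree K, t.exact = t.inputs.sum
  | leaf x => by simp [exact, inputs]
  | node _ l r => by simp [exact, inputs, exact_eq_sum l, exact_eq_sum r]

/-- `|s_k| ≤ Σ_{j ≺ k} |x_j|` (triangle inequality).
[cite: HallmanIpsen2023, §2, proof of Lemma "Relation between partial sums and inputs"] -/
theorem abs_exact_le_absInputs : ∀ t : CompTree K, |t.exact| ≤ t.absInputs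
  | leaf x => le_rfl
  | node _ l r => by
      simp only [exact, absInputs]
      exact (abs_add_le _ _).trans (add_le_add (abs_exact_le_absInputs l) (abs_exact_le_absInputs r))

end Basic

section Lemma5

/-- LEMMA (relation between partial sums and inputs), first bound:
`Σ_{k=2}^{n} |s_k| ≤ h Σ_{j=1}^{n} |x_j|`, `h` the height of the computational tree.
[cite: HallmanIpsen2023, §2, Lemma "Relation between partial sums and inputs" (Lem. 5 of the arXiv
text), first bound] -/
theorem sumAbsPartial_le : ∀ t : CompTree K, t.sumAbsPartial ≤ (t.height : K) * t.absInputs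
  | leaf x => by simp [sumAbsPartial, height]
  | node δ l r => by
      have ihl := sumAbsPartial_le l
      have ihr := sumAbsPartial_le r
      have hAl := absInputs_nonneg l
      have hAr := absInputs_nonneg r
      have hs := abs_exact_le_absInputs (node δ l r)
      simp only [exact, absInputs] at hs
      simp only [sumAbsPartial, height, absInputs, Nat.cast_add, Nat.cast_one]
      have h1 : (l.height : K) ≤ ((max l.height r.height : ℕ) : K) :=
        Nat.cast_le.mpr (le_max_left _ _)
      have h2 : (r.height : K) ≤ ((max l.height r.height : ℕ) : K) :=
        Nat.cast_le.mpr (le_max_right _ _)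
      have h0 : (0 : K) ≤ ((max l.height r.height : ℕ) : K) := Nat.cast_nonneg _
      nlinarith [mul_le_mul_of_nonneg_right h1 hAl, mul_le_mul_of_nonneg_right h2 hAr]

/-- `Σ_k s_k² ≤ (Σ_j |x_j|) · Σ_k |s_k|` (each `|s_k| ≤ Σ_j |x_j|`).
[cite: HallmanIpsen2023, §2, proof of Lemma "Relation between partial sums and inputs", second
display] -/
theorem sumSqPartial_le_mul : ∀ t : CompTree K, t.sumSqPartial ≤ t.absInputs * t.sumAbsPartial
  | leaf x => by simp [sumSqPartial, sumAbsPartial]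
  | node δ l r => by
      have ihl := sumSqPartial_le_mul l
      have ihr := sumSqPartial_le_mul r
      have hAl := absInputs_nonneg l
      have hAr := absInputs_nonneg r
      have hSl := sumAbsPartial_nonneg l
      have hSr := sumAbsPartial_nonneg r
      have hs := abs_exact_le_absInputs (node δ l r)
      simp only [exact, absInputs] at hs
      simp only [sumSqPartial, sumAbsPartial, absInputs]
      have hsq : (l.exact + r.exact) ^ 2 = |l.exact + r.exact| * |l.exact + r.exact| := by
        rw [abs_mul_abs_self, pow_two]
      rw [hsq]
      have e1 : |l.exact + r.exact| * |l.exact + r.exact|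
          ≤ (l.absInputs + r.absInputs) * |l.exact + r.exact| :=
        mul_le_mul_of_nonneg_right hs (abs_nonneg _)
      nlinarith [mul_le_mul_of_nonneg_right (le_add_of_nonneg_right hAr : l.absInputs ≤ _) hSl,
        mul_le_mul_of_nonneg_right (le_add_of_nonneg_left hAl : r.absInputs ≤ _) hSr]

/-- LEMMA (relation between partial sums and inputs), second bound, squared:
`Σ_{k=2}^{n} s_k² ≤ h (Σ_{j=1}^{n} |x_j|)²` (the source states `√(Σ s_k²) ≤ √h Σ |x_j|`).
[cite: HallmanIpsen2023, §2, Lemma "Relation between partial sums and inputs" (Lem. 5 of the arXiv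
text), second bound] -/
theorem sumSqPartial_le (t : CompTree K) : t.sumSqPartial ≤ (t.height : K) * t.absInputs ^ 2 := by
  have h1 := sumSqPartial_le_mul t
  have h2 := sumAbsPartial_le t
  have hA := absInputs_nonneg t
  calc t.sumSqPartial ≤ t.absInputs * t.sumAbsPartial := h1
    _ ≤ t.absInputs * ((t.height : K) * t.absInputs) := mul_le_mul_of_nonneg_left h2 hA
    _ = (t.height : K) * t.absInputs ^ 2 := by ring

end Lemma5

section Lemma6

omit [LinearOrder K] [IsStrictOrderedRing K] in
/-- LEMMA (first explicit expression): `e_n = ŝ_n − s_n = Σ_{k=2}^{n} s_k δ_k ∏_{k ≺ j ⪯ n}(1+δ_j)`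
— the forward error is the sum of the local errors `s_k δ_k`, each perturbed by the subsequent
rounding factors. [cite: HallmanIpsen2023, §2.1, Lemma "First explicit expression" (Lem. 6 of the arXiv
text, label lemma:forwardErrorGenl), eq. (eqn:forwardErrorGenl)] -/
theorem err_eq_sum_firstTerms : ∀ t : CompTree K, t.err = t.firstTerms.sum
  | leaf x => by simp [firstTerms]
  | node δ l r => by
      rw [err_node, firstTerms, List.sum_cons, List.map_append, List.sum_append,
        List.sum_map_mul_right, List.sum_map_mul_right]
      simp only [List.map_id']
      rw [← err_eq_sum_firstTerms l, ← err_eq_sum_firstTerms r]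
      ring

/-- The absolute terms are the absolute values of the terms of the first expression.
[cite: HallmanIpsen2023, §2.1, Theorem "deterministic bound", proof ("a direct consequence of
Lemma (lemma:forwardErrorGenl)")] -/
theorem firstAbsTerms_eq_map_abs : ∀ t : CompTree K, t.firstAbsTerms = t.firstTerms.map (|·|)
  | leaf x => by simp [firstTerms, firstAbsTerms]
  | node δ l r => by
      simp [firstAbsTerms, firstTerms, firstAbsTerms_eq_map_abs l, firstAbsTerms_eq_map_abs r,
        abs_mul, Function.comp_def]

end Lemma6

section Theorem7

/-- `|Σ L| ≤ Σ |L|` for a list (triangle inequality).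
[cite: HallmanIpsen2023, §2.1, Theorem "deterministic bound", proof] -/
theorem abs_list_sum_le : ∀ L : List K, |L.sum| ≤ (L.map (|·|)).sum
  | [] => by simp
  | a :: L => by
      simp only [List.sum_cons, List.map_cons]
      exact (abs_add_le _ _).trans (add_le_add le_rfl (abs_list_sum_le L))

/-- THEOREM (deterministic bound), first inequality:
`|e_n| ≤ Σ_{k=2}^{n} |s_k| |δ_k| ∏_{k ≺ j ⪯ n} |1 + δ_j|`.
[cite: HallmanIpsen2023, §2.1, Theorem "deterministic bound" (Thm. 7 of the arXiv text), first
inequality] -/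
theorem abs_err_le_sum_firstAbsTerms (t : CompTree K) : |t.err| ≤ t.firstAbsTerms.sum := by
  rw [err_eq_sum_firstTerms, firstAbsTerms_eq_map_abs]
  exact abs_list_sum_le _

/-- `|1 + δ| ≤ 1 + u` when `|δ| ≤ u`.
[cite: HallmanIpsen2023, §2.1, Theorem "deterministic bound" (`λ_h = (1+u)^h`)] -/
theorem abs_one_add_le {u δ : K} (h : |δ| ≤ u) : |1 + δ| ≤ 1 + u :=
  (abs_add_le 1 δ).trans (by rw [abs_one]; linarith)

/-- The absolute terms have a nonnegative sum.
[cite: HallmanIpsen2023, §2.1, Theorem "deterministic bound", first inequality] -/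
theorem sum_firstAbsTerms_nonneg (t : CompTree K) : 0 ≤ t.firstAbsTerms.sum := by
  rw [firstAbsTerms_eq_map_abs]
  exact List.sum_nonneg (by
    intro a ha
    obtain ⟨b, _, rfl⟩ := List.mem_map.mp ha
    exact abs_nonneg b)

/-- THEOREM (deterministic bound), second inequality: with `λ_h = (1+u)^h`,
`Σ_k |s_k| |δ_k| ∏_{k ≺ j ⪯ n} |1+δ_j| ≤ λ_h u Σ_{k=2}^{n} |s_k|`.
[cite: HallmanIpsen2023, §2.1, Theorem "deterministic bound" (Thm. 7 of the arXiv text), second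
inequality] -/
theorem sum_firstAbsTerms_le {u : K} (hu : 0 ≤ u) :
    ∀ t : CompTree K, t.Roundoff u →
      t.firstAbsTerms.sum ≤ (1 + u) ^ t.height * u * t.sumAbsPartial
  | leaf x, _ => by simp [firstAbsTerms, sumAbsPartial]
  | node δ l r, hR => by
      obtain ⟨hδ, hRl, hRr⟩ := hR
      have ihl := sum_firstAbsTerms_le hu l hRl
      have ihr := sum_firstAbsTerms_le hu r hRr
      have hAl := sum_firstAbsTerms_nonneg l
      have hAr := sum_firstAbsTerms_nonneg r
      have hSl := sumAbsPartial_nonneg l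
      have hSr := sumAbsPartial_nonneg r
      have h1δ := abs_one_add_le hδ
      have h1u : (1 : K) ≤ 1 + u := by linarith
      -- the powers
      have hpl : (1 + u) ^ l.height * (1 + u) ≤ (1 + u) ^ (max l.height r.height + 1) := by
        rw [pow_succ]
        exact mul_le_mul_of_nonneg_right (pow_le_pow_right₀ h1u (le_max_left _ _)) (by linarith)
      have hpr : (1 + u) ^ r.height * (1 + u) ≤ (1 + u) ^ (max l.height r.height + 1) := by
        rw [pow_succ]
        exact mul_le_mul_of_nonneg_right (pow_le_pow_right₀ h1u (le_max_right _ _)) (by linarith)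
      have hP1 : (1 : K) ≤ (1 + u) ^ (max l.height r.height + 1) := one_le_pow₀ h1u
      simp only [firstAbsTerms, height, sumAbsPartial, List.sum_cons, List.map_append,
        List.sum_append, List.sum_map_mul_right, List.map_id']
      set P := (1 + u) ^ (max l.height r.height + 1) with hP
      have e0 : |l.exact + r.exact| * |δ| ≤ P * u * |l.exact + r.exact| := by
        calc |l.exact + r.exact| * |δ| ≤ |l.exact + r.exact| * u :=
              mul_le_mul_of_nonneg_left hδ (abs_nonneg _)
          _ = 1 * u * |l.exact + r.exact| := by ring
          _ ≤ P * u * |l.exact + r.exact| := by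
              apply mul_le_mul_of_nonneg_right _ (abs_nonneg _)
              exact mul_le_mul_of_nonneg_right hP1 hu
      have e1 : l.firstAbsTerms.sum * |1 + δ| ≤ P * u * l.sumAbsPartial := by
        calc l.firstAbsTerms.sum * |1 + δ| ≤ ((1 + u) ^ l.height * u * l.sumAbsPartial) * (1 + u) :=
              mul_le_mul ihl h1δ (abs_nonneg _) (by positivity)
          _ = ((1 + u) ^ l.height * (1 + u)) * (u * l.sumAbsPartial) := by ring
          _ ≤ P * (u * l.sumAbsPartial) := mul_le_mul_of_nonneg_right hpl (by positivity)
          _ = P * u * l.sumAbsPartial := by ring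
      have e2 : r.firstAbsTerms.sum * |1 + δ| ≤ P * u * r.sumAbsPartial := by
        calc r.firstAbsTerms.sum * |1 + δ| ≤ ((1 + u) ^ r.height * u * r.sumAbsPartial) * (1 + u) :=
              mul_le_mul ihr h1δ (abs_nonneg _) (by positivity)
          _ = ((1 + u) ^ r.height * (1 + u)) * (u * r.sumAbsPartial) := by ring
          _ ≤ P * (u * r.sumAbsPartial) := mul_le_mul_of_nonneg_right hpr (by positivity)
          _ = P * u * r.sumAbsPartial := by ring
      nlinarith [e0, e1, e2]

/-- THEOREM (deterministic bound), third inequality: `λ_h u Σ_k |s_k| ≤ λ_h h u Σ_j |x_j|`.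
[cite: HallmanIpsen2023, §2.1, Theorem "deterministic bound" (Thm. 7 of the arXiv text), third
inequality (from Lemma "Relation between partial sums and inputs")] -/
theorem lambda_mul_sumAbsPartial_le {u : K} (hu : 0 ≤ u) (t : CompTree K) :
    (1 + u) ^ t.height * u * t.sumAbsPartial
      ≤ (1 + u) ^ t.height * (t.height : K) * u * t.absInputs := by
  have h := sumAbsPartial_le t
  have hP : (0 : K) ≤ (1 + u) ^ t.height * u := by positivity
  calc (1 + u) ^ t.height * u * t.sumAbsPartial
      ≤ (1 + u) ^ t.height * u * ((t.height : K) * t.absInputs) := mul_le_mul_of_nonneg_left h hP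
    _ = (1 + u) ^ t.height * (t.height : K) * u * t.absInputs := by ring

/-- THEOREM (deterministic bound for general summation on a computational tree of height `h`):
`|e_n| ≤ λ_h u Σ_{k=2}^{n} |s_k| ≤ λ_h h u Σ_{j=1}^{n} |x_j|`, `λ_h = (1 + u)^h`, for roundoffs
`|δ_k| ≤ u`. [cite: HallmanIpsen2023, §2.1, Theorem "deterministic bound" (Thm. 7 of the arXiv
text)] -/
theorem abs_err_le {u : K} (hu : 0 ≤ u) (t : CompTree K) (hR : t.Roundoff u) :
    |t.err| ≤ (1 + u) ^ t.height * u * t.sumAbsPartial ∧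
      |t.err| ≤ (1 + u) ^ t.height * (t.height : K) * u * t.absInputs := by
  have h1 := (abs_err_le_sum_firstAbsTerms t).trans (sum_firstAbsTerms_le hu t hR)
  exact ⟨h1, h1.trans (lambda_mul_sumAbsPartial_le hu t)⟩

end Theorem7

section Lemma9

omit [LinearOrder K] [IsStrictOrderedRing K] in
/-- The child-error recurrence `f_k = Σ_{j ≺ k} (s_j + f_j) δ_j` (sum over the strict descendants).
[cite: HallmanIpsen2023, §2.1, Lemma "Second explicit expression", eq. (eqn:frecurrence)] -/
theorem childErr_eq_sum_secondTerms :
    ∀ t : CompTree K, t.childErr = (match t with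
      | leaf _ => ([] : List K)
      | node _ l r => secondTerms l ++ secondTerms r).sum
  | leaf x => by simp [childErr]
  | node δ l r => by
      simp only [childErr, List.sum_append]
      rw [err_eq_sum_secondTerms l, err_eq_sum_secondTerms r]
where
  /-- LEMMA (second explicit expression): `e_n = ŝ_n − s_n = Σ_{j=2}^{n} (s_j + f_j) δ_j`, with the
  child-errors `f_j`. [cite: HallmanIpsen2023, §2.1, Lemma "Second explicit expression" (Lem. 9 of
  the arXiv text, label lemma:forwardErrorRec), first display] -/
  err_eq_sum_secondTerms : ∀ t : CompTree K, t.err = t.secondTerms.sum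
  | leaf x => by simp [secondTerms]
  | node δ l r => by
      rw [err_node_eq_childErr, secondTerms, List.sum_cons, List.sum_append,
        ← err_eq_sum_secondTerms l, ← err_eq_sum_secondTerms r]
      simp only [childErr, exact]
      ring

omit [LinearOrder K] [IsStrictOrderedRing K] in
/-- LEMMA (second explicit expression), restated at top level: `e_n = Σ_{j=2}^{n} (s_j + f_j) δ_j`.
[cite: HallmanIpsen2023, §2.1, Lemma "Second explicit expression" (Lem. 9 of the arXiv text)] -/
theorem err_eq_sum_secondTerms' (t : CompTree K) : t.err = t.secondTerms.sum :=
  childErr_eq_sum_secondTerms.err_eq_sum_secondTerms t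

omit [LinearOrder K] [IsStrictOrderedRing K] in
/-- The child-error of a node is the sum of the second-expression terms of its two subtrees:
`f_k = Σ_{j ≺ k} (s_j + f_j) δ_j`. [cite: HallmanIpsen2023, §2.1, Lemma "Second explicit
expression", eq. (eqn:frecurrence); Example (n = 8 pairwise tree)] -/
theorem childErr_node (δ : K) (l r : CompTree K) :
    (node δ l r).childErr = (l.secondTerms ++ r.secondTerms).sum :=
  childErr_eq_sum_secondTerms (node δ l r)

end Lemma9

section Higham1993

omit [LinearOrder K] [IsStrictOrderedRing K] in
/-- Higham's exact error expression for the general class of summation methods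
`T_k = T_{k₁} + T_{k₂}` (`k = n+1 … 2n−1`): the local error of forming `T̂_k = (T̂_{k₁} + T̂_{k₂})(1+δ_k)`
is `(T̂_{k₁} + T̂_{k₂}) δ_k = T̂_k δ_k/(1+δ_k)`, and `E_n = Ŝ_n − S_n = Σ_{k=n+1}^{2n−1} T̂_k δ_k/(1+δ_k)`
— the sum of the local errors, with NO perturbation factors.
[cite: Higham1993, p. 787, eqs. (3.2)–(3.3)] -/
theorem err_eq_sum_localErrs : ∀ t : CompTree K, t.err = t.localErrs.sum
  | leaf x => by simp [localErrs]
  | node δ l r => by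
      rw [localErrs, List.sum_cons, List.sum_append, ← err_eq_sum_localErrs l,
        ← err_eq_sum_localErrs r]
      simp only [err, comp, exact]
      ring

omit [LinearOrder K] [IsStrictOrderedRing K] in
/-- The local error written with the computed node value: `(T̂_{k₁} + T̂_{k₂}) δ_k = T̂_k δ_k / (1 + δ_k)`
(`1 + δ_k ≠ 0`). [cite: Higham1993, p. 787, text before eq. (3.3)] -/
theorem localErr_eq_div {δ : K} (hδ : 1 + δ ≠ 0) (l r : CompTree K) :
    (l.comp + r.comp) * δ = (node δ l r).comp * δ / (1 + δ) := by
  simp only [comp]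
  field_simp

/-- `0 ≤ Σ_k |ŝ_k|`. [cite: Higham1993, p. 787, eq. (3.4)] -/
theorem sumAbsComp_nonneg : ∀ t : CompTree K, 0 ≤ t.sumAbsComp
  | leaf _ => le_rfl
  | node δ l r => by
      simp only [sumAbsComp]
      have := sumAbsComp_nonneg l; have := sumAbsComp_nonneg r; positivity

/-- Higham's bound in terms of the COMPUTED partial sums: from (3.3) and `|δ_k/(1+δ_k)| ≤ u/(1−u)`,
`|E_n| ≤ (u/(1−u)) Σ_{k=n+1}^{2n−1} |T̂_k|` (all orders; the source's (3.4) is this bound, which it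
also weakens to `(n−1)u Σ|x_i| + O(u²)` in (3.5)).
[cite: Higham1993, p. 787, eqs. (3.3)–(3.4); HallmanIpsen2023, §2.1, Remark 8 of the arXiv text
(`|e_n| ≤ u Σ_k |ŝ_k|` to first order)] -/
theorem abs_err_le_sumAbsComp {u : K} (hu : 0 ≤ u) (hu1 : u < 1) :
    ∀ t : CompTree K, t.Roundoff u → |t.err| ≤ u / (1 - u) * t.sumAbsComp
  | leaf x, _ => by simp [sumAbsComp]
  | node δ l r, hR => by
      obtain ⟨hδ, hRl, hRr⟩ := hR
      have ihl := abs_err_le_sumAbsComp hu hu1 l hRl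
      have ihr := abs_err_le_sumAbsComp hu hu1 r hRr
      have h1u : (0 : K) < 1 - u := by linarith
      have hd := abs_le.mp hδ
      have h1δ : 1 - u ≤ |1 + δ| := by
        rw [abs_eq_max_neg]; exact le_max_of_le_left (by linarith)
      have h1δ0 : (0 : K) < |1 + δ| := lt_of_lt_of_le h1u h1δ
      -- the local error at this node
      have eloc : |(l.comp + r.comp) * δ| ≤ u / (1 - u) * |(l.comp + r.comp) * (1 + δ)| := by
        rw [abs_mul, abs_mul, div_mul_eq_mul_div, le_div_iff₀ h1u]
        calc |l.comp + r.comp| * |δ| * (1 - u) ≤ |l.comp + r.comp| * u * |1 + δ| := by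
              have := mul_le_mul hδ h1δ h1u.le hu
              calc |l.comp + r.comp| * |δ| * (1 - u) = |l.comp + r.comp| * (|δ| * (1 - u)) := by ring
                _ ≤ |l.comp + r.comp| * (u * |1 + δ|) :=
                    mul_le_mul_of_nonneg_left this (abs_nonneg _)
                _ = |l.comp + r.comp| * u * |1 + δ| := by ring
          _ = u * (|l.comp + r.comp| * |1 + δ|) := by ring
      have key : (node δ l r).err = l.err + r.err + (l.comp + r.comp) * δ := by
        simp only [err, comp, exact]; ring
      rw [key, sumAbsComp]
      calc |l.err + r.err + (l.comp + r.comp) * δ|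
          ≤ |l.err| + |r.err| + |(l.comp + r.comp) * δ| := by
            have := abs_add_le (l.err + r.err) ((l.comp + r.comp) * δ)
            have := abs_add_le l.err r.err
            linarith
        _ ≤ u / (1 - u) * l.sumAbsComp + u / (1 - u) * r.sumAbsComp
            + u / (1 - u) * |(l.comp + r.comp) * (1 + δ)| := by linarith
        _ = u / (1 - u) * (|(l.comp + r.comp) * (1 + δ)| + l.sumAbsComp + r.sumAbsComp) := by ring

omit [LinearOrder K] [IsStrictOrderedRing K] in
/-- The computed sum expanded over the inputs: `Ŝ_n = Σ_i x_i ∏ (1 + δ)`, each input multiplied by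
the rounding factors of exactly the additions it takes part in (for recursive summation
`Ŝ_n = (x₁ + x₂)∏_{k=2}^{n}(1+δ_k) + Σ_{i=3}^{n} x_i ∏_{k=i}^{n}(1+δ_k)`; for pairwise summation of
`n = 2^r` numbers each input takes part in `log₂ n` additions).
[cite: Higham1993, eq. (2.2) and p. 788 (display before eq. (3.6))] -/
theorem comp_eq_sum_leafTerms : ∀ t : CompTree K, t.comp = t.leafTerms.sum
  | leaf x => by simp [comp, leafTerms]
  | node δ l r => by
      rw [comp, leafTerms, List.map_append, List.sum_append, List.sum_map_mul_right,
        List.sum_map_mul_right]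
      simp only [List.map_id']
      rw [← comp_eq_sum_leafTerms l, ← comp_eq_sum_leafTerms r]
      ring

/-- `0 ≤ Σ_i |x_i|((1+u)^{d_i} − 1)` for `u ≥ 0`. [cite: Higham1993, eqs. (2.4)–(2.5)] -/
theorem leafBound_nonneg {u : K} (hu : 0 ≤ u) : ∀ t : CompTree K, 0 ≤ t.leafBound u
  | leaf _ => le_rfl
  | node _ l r => by
      simp only [leafBound]
      have := leafBound_nonneg hu l; have := leafBound_nonneg hu r
      have := absInputs_nonneg l; have := absInputs_nonneg r
      positivity

/-- Depth-wise bound: `|E_n| ≤ Σ_i |x_i| ((1+u)^{d_i} − 1)`, `d_i` = the number of additions `x_i`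
takes part in — the all-orders form of Higham's ordering-dependent bound (2.4)–(2.5)
(`|E_n| ≤ (|x₁| + |x₂|) γ_{n−1} + Σ_{i=3}^{n} |x_i| γ_{n−i+1}` for recursive summation, since
`(1+u)^k − 1 ≤ γ_k`). [cite: Higham1993, eqs. (2.2)–(2.5)] -/
theorem abs_err_le_leafBound {u : K} (hu : 0 ≤ u) :
    ∀ t : CompTree K, t.Roundoff u → |t.err| ≤ t.leafBound u
  | leaf x, _ => by simp [leafBound]
  | node δ l r, hR => by
      obtain ⟨hδ, hRl, hRr⟩ := hR
      have ihl := abs_err_le_leafBound hu l hRl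
      have ihr := abs_err_le_leafBound hu r hRr
      have h1δ := abs_one_add_le hδ
      have hs := abs_exact_le_absInputs (node δ l r)
      simp only [exact, absInputs] at hs
      rw [err_node, leafBound]
      calc |(l.err + r.err) * (1 + δ) + (l.exact + r.exact) * δ|
          ≤ |(l.err + r.err) * (1 + δ)| + |(l.exact + r.exact) * δ| := abs_add_le _ _
        _ = |l.err + r.err| * |1 + δ| + |l.exact + r.exact| * |δ| := by rw [abs_mul, abs_mul]
        _ ≤ (|l.err| + |r.err|) * (1 + u) + (l.absInputs + r.absInputs) * u := by
            have := abs_add_le l.err r.err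
            exact add_le_add (mul_le_mul this h1δ (abs_nonneg _) (by positivity))
              (mul_le_mul hs hδ (abs_nonneg _) (add_nonneg (absInputs_nonneg l) (absInputs_nonneg r)))
        _ ≤ (l.leafBound u + r.leafBound u) * (1 + u) + (l.absInputs + r.absInputs) * u := by
            have : (0 : K) ≤ 1 + u := by linarith
            nlinarith
        _ = (1 + u) * (l.leafBound u + r.leafBound u) + u * (l.absInputs + r.absInputs) := by ring

/-- `Σ_i |x_i| ((1+u)^{d_i} − 1) ≤ ((1+u)^h − 1) Σ_i |x_i|`, `h` the height (every depth `d_i ≤ h`).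
[cite: Higham1993, p. 788, eq. (3.6) (pairwise summation: every `d_i = log₂ n = h`)] -/
theorem leafBound_le {u : K} (hu : 0 ≤ u) :
    ∀ t : CompTree K, t.leafBound u ≤ ((1 + u) ^ t.height - 1) * t.absInputs
  | leaf x => by simp [leafBound, height]
  | node δ l r => by
      have ihl := leafBound_le hu l
      have ihr := leafBound_le hu r
      have hAl := absInputs_nonneg l
      have hAr := absInputs_nonneg r
      have h1u : (1 : K) ≤ 1 + u := by linarith
      have hml : (1 + u) ^ l.height ≤ (1 + u) ^ max l.height r.height :=
        pow_le_pow_right₀ h1u (le_max_left _ _)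
      have hmr : (1 + u) ^ r.height ≤ (1 + u) ^ max l.height r.height :=
        pow_le_pow_right₀ h1u (le_max_right _ _)
      simp only [leafBound, height, absInputs, pow_succ]
      have e1 : l.leafBound u ≤ ((1 + u) ^ max l.height r.height - 1) * l.absInputs :=
        ihl.trans (mul_le_mul_of_nonneg_right (by linarith) hAl)
      have e2 : r.leafBound u ≤ ((1 + u) ^ max l.height r.height - 1) * r.absInputs :=
        ihr.trans (mul_le_mul_of_nonneg_right (by linarith) hAr)
      have h0 : (0 : K) ≤ 1 + u := by linarith
      nlinarith [mul_le_mul_of_nonneg_left (add_le_add e1 e2) h0]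

/-- PAIRWISE-TYPE BOUND for any computational tree of height `h` with roundoffs `|δ_k| ≤ u`:
`|E_n| ≤ ((1+u)^h − 1) Σ_i |x_i| ≤ γ_h Σ_i |x_i|`, `γ_h = hu/(1 − hu)` (`hu < 1`). For pairwise
summation of `n = 2^r` numbers `h = log₂ n` and this is Higham's (3.6), `|E_n| ≤ γ_{log₂ n} Σ|x_i|`;
for recursive summation `h = n − 1` and it is (2.6), `|E_n| ≤ γ_{n−1} Σ|x_i|`.
[cite: Higham1993, p. 788, eq. (3.6); p. 785, eq. (2.6)] -/
theorem abs_err_le_gamma {u : K} (hu : 0 ≤ u) (t : CompTree K) (hR : t.Roundoff u) :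
    |t.err| ≤ ((1 + u) ^ t.height - 1) * t.absInputs ∧
      ((t.height : K) * u < 1 → |t.err| ≤ gamma u t.height * t.absInputs) := by
  have h1 := (abs_err_le_leafBound hu t hR).trans (leafBound_le hu t)
  refine ⟨h1, fun hh => h1.trans ?_⟩
  exact mul_le_mul_of_nonneg_right (one_add_pow_sub_one_le_gamma hu hh) (absInputs_nonneg t)

end Higham1993

section Constructions

/-! ### The two standard computational trees: sequential (recursive) and pairwise summation -/

/-- SEQUENTIAL (recursive) summation `s₁ = x₁`, `s_k = s_{k−1} + x_k`: starting from the tree `acc`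
already built, append the remaining inputs one addition at a time; the `k`-th addition carries the
roundoff `δ k`. [cite: HallmanIpsen2023, §2, Definition "Computational tree" ("Sequential summation
yields a tree of height n − 1"); Higham1993, §2, eq. (2.1)] -/
def seqTree (δ : ℕ → K) : CompTree K → ℕ → List K → CompTree K
  | acc, _, [] => acc
  | acc, k, x :: xs => seqTree δ (node (δ k) acc (leaf x)) (k + 1) xs

/-- Recursive summation of `x₀, x₁, …` : the sequential tree on the leaf `x₀` and the list of the
remaining inputs, additions numbered from `1`. [cite: Higham1993, §2, eq. (2.1)] -/
def recursiveTree (δ : ℕ → K) (x₀ : K) (xs : List K) : CompTree K := seqTree δ (leaf x₀) 1 xs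

omit [Field K] [LinearOrder K] [IsStrictOrderedRing K] in
/-- The sequential tree has the leaves of `acc` followed by the appended inputs.
[cite: Higham1993, §2, eq. (2.1) (`S_k = S_{k−1} + x_k`)] -/
theorem inputs_seqTree (δ : ℕ → K) :
    ∀ (acc : CompTree K) (k : ℕ) (xs : List K), (seqTree δ acc k xs).inputs = acc.inputs ++ xs
  | acc, k, [] => by simp [seqTree]
  | acc, k, x :: xs => by simp [seqTree, inputs_seqTree δ _ (k + 1) xs, inputs]

omit [Field K] [LinearOrder K] [IsStrictOrderedRing K] in
/-- Each appended input raises the height by one. [cite: HallmanIpsen2023, §2, Definition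
"Computational tree" ("Sequential summation yields a tree of height n − 1")] -/
theorem height_seqTree (δ : ℕ → K) :
    ∀ (acc : CompTree K) (k : ℕ) (xs : List K), (seqTree δ acc k xs).height = acc.height + xs.length
  | acc, k, [] => by simp [seqTree]
  | acc, k, x :: xs => by
      simp [seqTree, height_seqTree δ _ (k + 1) xs, height]
      omega

omit [Field K] [LinearOrder K] [IsStrictOrderedRing K] in
/-- The recursive-summation tree on `n` inputs has the inputs as leaves and height `n − 1`.
[cite: HallmanIpsen2023, §2, Definition "Computational tree" ("Sequential summation yields a tree
of height n − 1")] -/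
theorem recursiveTree_inputs_height (δ : ℕ → K) (x₀ : K) (xs : List K) :
    (recursiveTree δ x₀ xs).inputs = x₀ :: xs ∧ (recursiveTree δ x₀ xs).height = xs.length := by
  simp [recursiveTree, inputs_seqTree, height_seqTree, inputs, height]

/-- One stage of PAIRWISE (cascade) summation on a forest: `y_i = t_{2i−1} + t_{2i}` (the last tree
is passed through unchanged when their number is odd); the `i`-th addition of the stage carries
the roundoff `δ i`. [cite: Higham1993, p. 788 (pairwise summation: "the x_i are summed in pairs,
y_i = x_{2i−1} + x_{2i} … and this pairwise summation process is repeated recursively on the y_i")] -/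
def pairStage (δ : ℕ → K) : ℕ → List (CompTree K) → List (CompTree K)
  | _, [] => []
  | _, [t] => [t]
  | i, t₁ :: t₂ :: ts => node (δ i) t₁ t₂ :: pairStage δ (i + 1) ts

omit [Field K] [LinearOrder K] [IsStrictOrderedRing K] in
/-- One pairing stage leaves `⌈m/2⌉` trees. [cite: Higham1993, p. 788 (`y_i = x_{2i−1} + x_{2i}`,
`i = 1 : ⌊n/2⌋` (`y_{(n+1)/2} = x_n` if `n` is odd))] -/
theorem length_pairStage (δ : ℕ → K) :
    ∀ (i : ℕ) (ts : List (CompTree K)), (pairStage δ i ts).length = (ts.length + 1) / 2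
  | i, [] => by simp [pairStage]
  | i, [t] => by simp [pairStage]
  | i, t₁ :: t₂ :: ts => by
      simp only [pairStage, List.length_cons, length_pairStage δ (i + 1) ts]
      omega

/-- The leaves of a forest, left to right. [cite: HallmanIpsen2023, §2, Definition
"Computational tree" ("the leaves are the inputs")] -/
def forestInputs : List (CompTree K) → List K
  | [] => []
  | t :: ts => t.inputs ++ forestInputs ts

/-- The maximal height of the trees of a forest. [cite: HallmanIpsen2023, §2, Definition
"Computational tree" (height)] -/
def forestHeight : List (CompTree K) → ℕ
  | [] => 0
  | t :: ts => max t.height (forestHeight ts)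

omit [Field K] [LinearOrder K] [IsStrictOrderedRing K] in
/-- A pairing stage keeps the inputs (and their order). [cite: Higham1993, p. 788 (pairwise
summation process)] -/
theorem forestInputs_pairStage (δ : ℕ → K) :
    ∀ (i : ℕ) (ts : List (CompTree K)), forestInputs (pairStage δ i ts) = forestInputs ts
  | i, [] => by simp [pairStage]
  | i, [t] => by simp [pairStage]
  | i, t₁ :: t₂ :: ts => by
      simp [pairStage, forestInputs, forestInputs_pairStage δ (i + 1) ts, inputs]

omit [Field K] [LinearOrder K] [IsStrictOrderedRing K] in
/-- A pairing stage raises the height by at most one. [cite: Higham1993, p. 788 ("in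
⌈log₂ n⌉ stages")] -/
theorem forestHeight_pairStage (δ : ℕ → K) :
    ∀ (i : ℕ) (ts : List (CompTree K)), forestHeight (pairStage δ i ts) ≤ forestHeight ts + 1
  | i, [] => by simp [pairStage, forestHeight]
  | i, [t] => by simp [pairStage, forestHeight]
  | i, t₁ :: t₂ :: ts => by
      have ih := forestHeight_pairStage δ (i + 1) ts
      simp only [pairStage, forestHeight, height]
      omega

/-- PAIRWISE summation of a forest: repeat the pairing stage until one tree is left; stage `lvl`
uses the roundoffs `δ lvl 0, δ lvl 1, …`. (The empty forest is sent to the leaf `0`.)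
[cite: Higham1993, p. 788 ("this pairwise summation process is repeated recursively on the y_i …
The sum is obtained in ⌈log₂ n⌉ stages"); HallmanIpsen2023, §2, Definition "Computational tree"
("another of height ⌈log₂ n⌉ for pairwise summation")] -/
def pairForest (δ : ℕ → ℕ → K) (lvl : ℕ) : List (CompTree K) → CompTree K
  | [] => leaf 0
  | [t] => t
  | t₁ :: t₂ :: ts => pairForest δ (lvl + 1) (pairStage (δ lvl) 0 (t₁ :: t₂ :: ts))
  termination_by ts => ts.length
  decreasing_by
    rw [length_pairStage]
    simp only [List.length_cons]
    omega

/-- The pairwise-summation computational tree of the inputs `x₁, …, x_n`.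
[cite: Higham1993, p. 788; HallmanIpsen2023, §2, Definition "Computational tree"] -/
def pairwiseTree (δ : ℕ → ℕ → K) (xs : List K) : CompTree K := pairForest δ 0 (xs.map leaf)

omit [LinearOrder K] [IsStrictOrderedRing K] in
/-- Pairwise summation of a nonempty forest keeps the inputs (and their order).
[cite: Higham1993, p. 788 (pairwise summation process)] -/
theorem inputs_pairForest (δ : ℕ → ℕ → K) :
    ∀ (lvl : ℕ) (ts : List (CompTree K)), ts ≠ [] → (pairForest δ lvl ts).inputs = forestInputs ts
  | lvl, [], h => (h rfl).elim
  | lvl, [t], _ => by simp [pairForest, forestInputs]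
  | lvl, t₁ :: t₂ :: ts, _ => by
      rw [pairForest, inputs_pairForest δ (lvl + 1) _ (by simp [pairStage]), forestInputs_pairStage]
  termination_by _ ts => ts.length
  decreasing_by
    rw [length_pairStage]
    simp only [List.length_cons]
    omega

omit [LinearOrder K] [IsStrictOrderedRing K] in
/-- Height of the pairwise tree of a nonempty forest: at most the forest height plus `⌈log₂ m⌉`,
`m` the number of trees. [cite: Higham1993, p. 788 ("The sum is obtained in ⌈log₂ n⌉ stages")] -/
theorem height_pairForest (δ : ℕ → ℕ → K) :
    ∀ (lvl : ℕ) (ts : List (CompTree K)), ts ≠ [] →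
      (pairForest δ lvl ts).height ≤ forestHeight ts + Nat.clog 2 ts.length
  | lvl, [], h => (h rfl).elim
  | lvl, [t], _ => by simp [pairForest, forestHeight]
  | lvl, t₁ :: t₂ :: ts, _ => by
      rw [pairForest]
      have ih := height_pairForest δ (lvl + 1) (pairStage (δ lvl) 0 (t₁ :: t₂ :: ts))
        (by simp [pairStage])
      have hlen := length_pairStage (δ lvl) 0 (t₁ :: t₂ :: ts)
      have hfh := forestHeight_pairStage (δ lvl) 0 (t₁ :: t₂ :: ts)
      have hclog : Nat.clog 2 (t₁ :: t₂ :: ts).length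
          = Nat.clog 2 (((t₁ :: t₂ :: ts).length + 2 - 1) / 2) + 1 :=
        Nat.clog_of_two_le (by norm_num) (by simp)
      rw [hlen] at ih
      have e : ((t₁ :: t₂ :: ts).length + 2 - 1) / 2 = ((t₁ :: t₂ :: ts).length + 1) / 2 := by omega
      rw [e] at hclog
      omega
  termination_by _ ts => ts.length
  decreasing_by
    rw [length_pairStage]
    simp only [List.length_cons]
    omega

omit [LinearOrder K] [IsStrictOrderedRing K] in
/-- The PAIRWISE-SUMMATION tree on `n ≥ 1` inputs has the inputs as leaves, in order, and height at
most `⌈log₂ n⌉`. [cite: Higham1993, p. 788 ("The sum is obtained in ⌈log₂ n⌉ stages … each addend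
takes part in the same number of additions, log₂ n" for n = 2^r); HallmanIpsen2023, §2, Definition
"Computational tree" ("another of height ⌈log₂ n⌉ for pairwise summation")] -/
theorem pairwiseTree_inputs_height (δ : ℕ → ℕ → K) (xs : List K) (hxs : xs ≠ []) :
    (pairwiseTree δ xs).inputs = xs ∧ (pairwiseTree δ xs).height ≤ Nat.clog 2 xs.length := by
  have hne : xs.map leaf ≠ ([] : List (CompTree K)) := by simpa using hxs
  have hin : forestInputs (xs.map leaf) = xs := by
    clear hne hxs
    induction xs with
    | nil => rfl
    | cons x xs ih => simp [forestInputs, inputs, ih]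
  have hfh : forestHeight (xs.map (leaf : K → CompTree K)) = 0 := by
    clear hne hxs hin
    induction xs with
    | nil => rfl
    | cons x xs ih => simp [forestHeight, height, ih]
  refine ⟨by rw [pairwiseTree, inputs_pairForest δ 0 _ hne, hin], ?_⟩
  have h := height_pairForest δ 0 (xs.map leaf) hne
  rw [hfh, List.length_map] at h
  simpa [pairwiseTree] using h

/-- PAIRWISE SUMMATION ERROR BOUND: for `n ≥ 1` inputs and roundoffs `|δ| ≤ u`,
`|E_n| ≤ ((1+u)^{⌈log₂ n⌉} − 1) Σ_i |x_i|` (Higham: `≤ γ_{log₂ n} Σ|x_i|` for `n = 2^r`), and the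
Hallman–Ipsen form `|e_n| ≤ λ_h h u Σ|x_j|` with `h ≤ ⌈log₂ n⌉`.
[cite: Higham1993, p. 788, eq. (3.6); HallmanIpsen2023, §2.1, Theorem "deterministic bound" with
§2 Definition "Computational tree" (pairwise height ⌈log₂ n⌉)] -/
theorem pairwise_abs_err_le {u : K} (hu : 0 ≤ u) (δ : ℕ → ℕ → K) (xs : List K) (hxs : xs ≠ [])
    (hR : (pairwiseTree δ xs).Roundoff u) :
    |(pairwiseTree δ xs).err| ≤ ((1 + u) ^ Nat.clog 2 xs.length - 1) * (xs.map (|·|)).sum := by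
  obtain ⟨hin, hh⟩ := pairwiseTree_inputs_height δ xs hxs
  have h1 := (abs_err_le_gamma hu _ hR).1
  have hA : (pairwiseTree δ xs).absInputs = (xs.map (|·|)).sum := by rw [absInputs_eq_sum, hin]
  rw [hA] at h1
  refine h1.trans (mul_le_mul_of_nonneg_right ?_ ?_)
  · have h1u : (1 : K) ≤ 1 + u := by linarith
    linarith [pow_le_pow_right₀ h1u hh]
  · rw [← hA]; exact absInputs_nonneg _

end Constructions

end CompTree

/-! ## Compensated (Kahan) sequential summation: exact error recurrences
(Hallman–Ipsen §4.1 of the arXiv text = the section "Compensated sequential summation") -/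

namespace Compensated

variable {K : Type*} [Field K]

/-- The finite-precision model of COMPENSATED SUMMATION (Kahan's summation formula in Goldberg's
formulation `s₁ = x₁, c₁ = 0; y_k = x_k − c_{k−1}, s_k = s_{k−1} + y_k, c_k = (s_k − s_{k−1}) − y_k`):
the pair `(ŝ_k, ĉ_k)` with `ŝ₁ = x₁`, `ĉ₁ = 0`, `ŷ_k = (x_k − ĉ_{k−1})(1+η_k)`,
`ŝ_k = (ŝ_{k−1} + ŷ_k)(1+σ_k)`, `ẑ_k = (ŝ_k − ŝ_{k−1})(1+δ_k)`, `ĉ_k = (ẑ_k − ŷ_k)(1+β_k)`, `k ≥ 2`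
(index `0` is unused and set to `(0, 0)`; inputs `x 1, x 2, …`).
[cite: HallmanIpsen2023, §4, Algorithm "Compensated Summation" and eq. (e_model1)] -/
def state (x η σ δ β : ℕ → K) : ℕ → K × K
  | 0 => (0, 0)
  | 1 => (x 1, 0)
  | k + 2 =>
      ( ((state x η σ δ β (k + 1)).1
          + (x (k + 2) - (state x η σ δ β (k + 1)).2) * (1 + η (k + 2))) * (1 + σ (k + 2)),
        ( (((state x η σ δ β (k + 1)).1
              + (x (k + 2) - (state x η σ δ β (k + 1)).2) * (1 + η (k + 2))) * (1 + σ (k + 2))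
            - (state x η σ δ β (k + 1)).1) * (1 + δ (k + 2))
          - (x (k + 2) - (state x η σ δ β (k + 1)).2) * (1 + η (k + 2)) ) * (1 + β (k + 2)) )

section Model

variable (x η σ δ β : ℕ → K)

/-- Computed sum `ŝ_k`. [cite: HallmanIpsen2023, §4, eq. (e_model1)] -/
def hatS (k : ℕ) : K := (state x η σ δ β k).1

/-- Computed correction `ĉ_k`. [cite: HallmanIpsen2023, §4, eq. (e_model1)] -/
def hatC (k : ℕ) : K := (state x η σ δ β k).2

/-- Computed `ŷ_k = (x_k − ĉ_{k−1})(1 + η_k)` (`k ≥ 2`). [cite: HallmanIpsen2023, §4, eq. (e_model1)] -/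
def hatY : ℕ → K
  | 0 => 0
  | k + 1 => (x (k + 1) - hatC x η σ δ β k) * (1 + η (k + 1))

/-- Computed `ẑ_k = (ŝ_k − ŝ_{k−1})(1 + δ_k)` (`k ≥ 2`). [cite: HallmanIpsen2023, §4, eq. (e_model1)] -/
def hatZ : ℕ → K
  | 0 => 0
  | k + 1 => (hatS x η σ δ β (k + 1) - hatS x η σ δ β k) * (1 + δ (k + 1))

/-- Exact partial sum `s_k = x₁ + ⋯ + x_k`. [cite: HallmanIpsen2023, §2 ("s_k = Σ_{j=1}^{k} x_j")] -/
def psum : ℕ → K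
  | 0 => 0
  | k + 1 => psum k + x (k + 1)

/-- Forward error `ṡ_k = ŝ_k − s_k`. [cite: HallmanIpsen2023, §4.1, eq. (def:compFwdErr)] -/
def dS (k : ℕ) : K := hatS x η σ δ β k - psum x k
/-- Forward error `ẏ_k = ŷ_k − x_k`. [cite: HallmanIpsen2023, §4.1, eq. (def:compFwdErr)] -/
def dY (k : ℕ) : K := hatY x η σ δ β k - x k
/-- Forward error `ż_k = ẑ_k − x_k`. [cite: HallmanIpsen2023, §4.1, eq. (def:compFwdErr)] -/
def dZ (k : ℕ) : K := hatZ x η σ δ β k - x k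
/-- Forward error `ċ_k = ĉ_k`. [cite: HallmanIpsen2023, §4.1, eq. (def:compFwdErr)] -/
def dC (k : ℕ) : K := hatC x η σ δ β k

/-- Child-error `ÿ_k = −ċ_{k−1}` (`k ≥ 2`). [cite: HallmanIpsen2023, §4.1, eq. (def:compChiErr)] -/
def ddY : ℕ → K
  | 0 => 0
  | k + 1 => - dC x η σ δ β k
/-- Child-error `s̈_k = ṡ_{k−1} + ẏ_k` (`k ≥ 2`). [cite: HallmanIpsen2023, §4.1, eq. (def:compChiErr)] -/
def ddS : ℕ → K
  | 0 => 0
  | k + 1 => dS x η σ δ β k + dY x η σ δ β (k + 1)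
/-- Child-error `z̈_k = ṡ_k − ṡ_{k−1}` (`k ≥ 2`). [cite: HallmanIpsen2023, §4.1, eq. (def:compChiErr)] -/
def ddZ : ℕ → K
  | 0 => 0
  | k + 1 => dS x η σ δ β (k + 1) - dS x η σ δ β k
/-- Child-error `c̈_k = ż_k − ẏ_k`. [cite: HallmanIpsen2023, §4.1, eq. (def:compChiErr)] -/
def ddC (k : ℕ) : K := dZ x η σ δ β k - dY x η σ δ β k

/-- `ŝ₁ = s₁ = x₁`. [cite: HallmanIpsen2023, §4, eq. (e_model1)] -/
@[simp] theorem hatS_one : hatS x η σ δ β 1 = x 1 := rfl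
/-- `ĉ₁ = 0`. [cite: HallmanIpsen2023, §4, eq. (e_model1)] -/
@[simp] theorem hatC_one : hatC x η σ δ β 1 = 0 := rfl
/-- `s₁ = x₁`. [cite: HallmanIpsen2023, §4, Algorithm "Compensated Summation" (`s_1 = x_1`)] -/
@[simp] theorem psum_one : psum x 1 = x 1 := by simp [psum]
/-- `s_k = s_{k−1} + x_k`. [cite: HallmanIpsen2023, §2 ("s_k = Σ_{j=1}^{k} x_j")] -/
theorem psum_succ (k : ℕ) : psum x (k + 1) = psum x k + x (k + 1) := rfl

/-- `ŷ_k = (x_k − ĉ_{k−1})(1 + η_k)`. [cite: HallmanIpsen2023, §4, eq. (e_model1)] -/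
theorem hatY_succ (k : ℕ) :
    hatY x η σ δ β (k + 1) = (x (k + 1) - hatC x η σ δ β k) * (1 + η (k + 1)) := rfl

/-- `ŝ_k = (ŝ_{k−1} + ŷ_k)(1 + σ_k)`. [cite: HallmanIpsen2023, §4, eq. (e_model1)] -/
theorem hatS_succ (k : ℕ) :
    hatS x η σ δ β (k + 2) = (hatS x η σ δ β (k + 1) + hatY x η σ δ β (k + 2)) * (1 + σ (k + 2)) := by
  simp only [hatS, hatY, hatC, state]

/-- `ẑ_k = (ŝ_k − ŝ_{k−1})(1 + δ_k)`. [cite: HallmanIpsen2023, §4, eq. (e_model1)] -/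
theorem hatZ_succ (k : ℕ) :
    hatZ x η σ δ β (k + 1) = (hatS x η σ δ β (k + 1) - hatS x η σ δ β k) * (1 + δ (k + 1)) := rfl

/-- `ĉ_k = (ẑ_k − ŷ_k)(1 + β_k)`. [cite: HallmanIpsen2023, §4, eq. (e_model1)] -/
theorem hatC_succ (k : ℕ) :
    hatC x η σ δ β (k + 2) = (hatZ x η σ δ β (k + 2) - hatY x η σ δ β (k + 2)) * (1 + β (k + 2)) := by
  simp only [hatC, hatZ, hatY, hatS, state]

end Model

section Recurrences

variable (x η σ δ β : ℕ → K)

/-- `ẏ_k = (x_k + ÿ_k) η_k + ÿ_k`. [cite: HallmanIpsen2023, §4.1, eq. (eqn:comp_ydot)] -/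
theorem dY_eq (k : ℕ) :
    dY x η σ δ β (k + 2) = (x (k + 2) + ddY x η σ δ β (k + 2)) * η (k + 2) + ddY x η σ δ β (k + 2) := by
  simp only [dY, ddY, dC, hatY_succ]
  ring

/-- `ṡ_k = (s_k + s̈_k) σ_k + s̈_k`. [cite: HallmanIpsen2023, §4.1, eq. (eqn:comp_sdot)] -/
theorem dS_eq (k : ℕ) :
    dS x η σ δ β (k + 2)
      = (psum x (k + 2) + ddS x η σ δ β (k + 2)) * σ (k + 2) + ddS x η σ δ β (k + 2) := by
  simp only [dS, ddS, dY, hatS_succ, psum_succ]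
  ring

/-- `ż_k = (x_k + z̈_k) δ_k + z̈_k`. [cite: HallmanIpsen2023, §4.1, eq. (eqn:comp_zdot)] -/
theorem dZ_eq (k : ℕ) :
    dZ x η σ δ β (k + 2) = (x (k + 2) + ddZ x η σ δ β (k + 2)) * δ (k + 2) + ddZ x η σ δ β (k + 2) := by
  simp only [dZ, ddZ, dS, hatZ_succ, psum_succ]
  ring

/-- `ċ_k = c̈_k β_k + c̈_k`. [cite: HallmanIpsen2023, §4.1, eq. (eqn:comp_cdot)] -/
theorem dC_eq (k : ℕ) :
    dC x η σ δ β (k + 2) = ddC x η σ δ β (k + 2) * β (k + 2) + ddC x η σ δ β (k + 2) := by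
  simp only [dC, ddC, dZ, dY, hatC_succ]
  ring

/-- THEOREM (child-error recurrences of compensated summation), initial values (`η₂ = 0` since
`ĉ₁ = 0` makes `ŷ₂ = x₂` exact): `ÿ₂ = 0`, `s̈₂ = 0`, `z̈₂ = s₂ σ₂`, `c̈₂ = (x₂ + z̈₂) δ₂ + s₂ σ₂`.
[cite: HallmanIpsen2023, §4.1, Theorem "child-errors in compensated summation" (Thm. 19 of the
arXiv text), eq. (eqn:cbase)] -/
theorem base (hη : η 2 = 0) :
    ddY x η σ δ β 2 = 0 ∧ ddS x η σ δ β 2 = 0 ∧ ddZ x η σ δ β 2 = psum x 2 * σ 2 ∧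
      ddC x η σ δ β 2 = (x 2 + ddZ x η σ δ β 2) * δ 2 + psum x 2 * σ 2 := by
  have h1 : ddY x η σ δ β 2 = 0 := by simp [ddY, dC]
  have h2 : ddS x η σ δ β 2 = 0 := by
    simp only [ddS, dS, dY, hatY_succ, hatS_one, hatC_one, psum_one, hη]; ring
  have h3 : ddZ x η σ δ β 2 = psum x 2 * σ 2 := by
    have e : ddZ x η σ δ β 2 = dS x η σ δ β 2 := by simp [ddZ, dS]
    rw [e, dS_eq, h2]; ring
  refine ⟨h1, h2, h3, ?_⟩
  have e : ddC x η σ δ β 2 = dZ x η σ δ β 2 - dY x η σ δ β 2 := rfl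
  rw [e, dZ_eq, dY_eq, h1, h3, hη]; ring

/-- THEOREM (child-error recurrences), `ÿ_k = −c̈_{k−1}(1 + β_{k−1})` (`k ≥ 3`).
[cite: HallmanIpsen2023, §4.1, Theorem "child-errors in compensated summation" (Thm. 19 of the
arXiv text), eq. (eqn:yrec)] -/
theorem ddY_rec (k : ℕ) : ddY x η σ δ β (k + 3) = - ddC x η σ δ β (k + 2) * (1 + β (k + 2)) := by
  have e : ddY x η σ δ β (k + 3) = - dC x η σ δ β (k + 2) := rfl
  rw [e, dC_eq]; ring

/-- THEOREM (child-error recurrences), `c̈_k = (x_k + z̈_k) δ_k + (s_k + s̈_k) σ_k` (`k ≥ 2`).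
[cite: HallmanIpsen2023, §4.1, Theorem "child-errors in compensated summation" (Thm. 19 of the
arXiv text), eq. (eqn:crec)] -/
theorem ddC_rec (k : ℕ) :
    ddC x η σ δ β (k + 2)
      = (x (k + 2) + ddZ x η σ δ β (k + 2)) * δ (k + 2)
        + (psum x (k + 2) + ddS x η σ δ β (k + 2)) * σ (k + 2) := by
  have e : ddC x η σ δ β (k + 2) = dZ x η σ δ β (k + 2) - dY x η σ δ β (k + 2) := rfl
  have hZ : ddZ x η σ δ β (k + 2) = dS x η σ δ β (k + 2) - dS x η σ δ β (k + 1) := rfl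
  have hSS : ddS x η σ δ β (k + 2) = dS x η σ δ β (k + 1) + dY x η σ δ β (k + 2) := rfl
  have hS := dS_eq x η σ δ β k
  rw [e, dZ_eq]
  -- `(x + z̈)δ + z̈ − ẏ = (x + z̈)δ + ṡ_k − (ṡ_{k−1} + ẏ_k) = (x + z̈)δ + ṡ_k − s̈_k = (x + z̈)δ + (s + s̈)σ`
  linear_combination hS + hZ + hSS

/-- THEOREM (child-error recurrences), `z̈_k = (s_k + s̈_k) σ_k + (x_k + ÿ_k) η_k + ÿ_k` (`k ≥ 2`).
[cite: HallmanIpsen2023, §4.1, Theorem "child-errors in compensated summation" (Thm. 19 of the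
arXiv text), eq. (eqn:zrec)] -/
theorem ddZ_rec (k : ℕ) :
    ddZ x η σ δ β (k + 2)
      = (psum x (k + 2) + ddS x η σ δ β (k + 2)) * σ (k + 2)
        + (x (k + 2) + ddY x η σ δ β (k + 2)) * η (k + 2) + ddY x η σ δ β (k + 2) := by
  have hZ : ddZ x η σ δ β (k + 2) = dS x η σ δ β (k + 2) - dS x η σ δ β (k + 1) := rfl
  have hSS : ddS x η σ δ β (k + 2) = dS x η σ δ β (k + 1) + dY x η σ δ β (k + 2) := rfl
  have hS := dS_eq x η σ δ β k
  have hY := dY_eq x η σ δ β k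
  rw [hZ]
  linear_combination hS + hY + hSS

/-- THEOREM (child-error recurrences), the one-step form of (eqn:srec):
`s̈_k = s̈_{k−1} + (x_k + ÿ_k) η_k − c̈_{k−1} β_{k−1} − (x_{k−1} + z̈_{k−1}) δ_{k−1}` (`k ≥ 3`).
[cite: HallmanIpsen2023, §4.1, proof of Theorem "child-errors in compensated summation", the
display deriving (eqn:srec)] -/
theorem ddS_step (k : ℕ) :
    ddS x η σ δ β (k + 3)
      = ddS x η σ δ β (k + 2) + (x (k + 3) + ddY x η σ δ β (k + 3)) * η (k + 3)
        - ddC x η σ δ β (k + 2) * β (k + 2)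
        - (x (k + 2) + ddZ x η σ δ β (k + 2)) * δ (k + 2) := by
  have hSS : ddS x η σ δ β (k + 3) = dS x η σ δ β (k + 2) + dY x η σ δ β (k + 3) := rfl
  have hS := dS_eq x η σ δ β k
  have hY : dY x η σ δ β (k + 3)
      = (x (k + 3) + ddY x η σ δ β (k + 3)) * η (k + 3) + ddY x η σ δ β (k + 3) :=
    dY_eq x η σ δ β (k + 1)
  have hYr := ddY_rec x η σ δ β k
  have hC := ddC_rec x η σ δ β k
  rw [hSS]
  linear_combination hS + hY + hYr - hC

/-- THEOREM (child-error recurrences), (eqn:srec) unrolled with `s̈₂ = 0`: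
`s̈_k = Σ_{j=3}^{k} [(x_j + ÿ_j) η_j − c̈_{j−1} β_{j−1} − (x_{j−1} + z̈_{j−1}) δ_{j−1}]` (`k ≥ 2`).
[cite: HallmanIpsen2023, §4.1, Theorem "child-errors in compensated summation" (Thm. 19 of the
arXiv text), eq. (eqn:srec)] -/
theorem ddS_eq_sum (hη : η 2 = 0) (k : ℕ) :
    ddS x η σ δ β (k + 2)
      = ∑ j ∈ Finset.Ico 3 (k + 3),
          ((x j + ddY x η σ δ β j) * η j - ddC x η σ δ β (j - 1) * β (j - 1)
            - (x (j - 1) + ddZ x η σ δ β (j - 1)) * δ (j - 1)) := by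
  induction k with
  | zero => simp [(base x η σ δ β hη).2.1]
  | succ k ih =>
      rw [show k + 1 + 2 = k + 3 from rfl, show k + 1 + 3 = k + 3 + 1 from rfl,
        Finset.sum_Ico_succ_top (by omega : 3 ≤ k + 3), ← ih, ddS_step]
      simp only [show k + 3 - 1 = k + 2 from rfl]
      ring

end Recurrences

end Compensated

end Literature.ComputerArithmetic.HallmanIpsen2023
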